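import Summits.SmoothPoincare4.SmoothPoincare4.Theorems.ConvexBisectionAcyclicBisectionExistsDualHandleSeamModelChartEmbedding
import Literature.Topology.FourManifolds.BoundaryGluingData
import Literature.Topology.FourManifolds.ClosedBallSmoothMaps
import HarnessLib

/-!
# The complement piece `W₂`, IIa: the open handle of Milnor's gluing as a chart of `ℝ⁴`
(helper file 2a of the wave-4 brick T3b (iii) "the complement piece `W₂ = {Φ ≤ 0}` of the pushed
prefix sub-handlebody inside Milnor's gluing" for stub `stub_steinRealisation` (NF6), line
`modp-braid-orbits` r11, crux `ConvexBisection.AcyclicBisectionExists`, item stmt-SmoothPoincare4-10508;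
lead c5, worker Y6)

Let `X = B ∪_{h̄} (handles)` (data `D`), `M' = X ∪_Ψ W = G.d₂.Glued` Milnor's gluing built from an open
collar `G.CM` adapted to the belt map of the `i`-th handle (`…DualHandleGluingCollars.lean`).  In
Kosinski's coordinates `x = (x_λ, x_μ) ∈ ℝ⁴` of the `i`-th handle (`D.jB i : D⁴ ∖ S → X`) this file
builds ONE chart `ℝ⁴ ⊇ 𝓥 → M'` covering the open handle AND a neighbourhood of the belt circle across
the seam (V5-REPORT §3.0: "extend `Ξ` to `𝓞 ∪ ({r < 1} ∖ S)` by `G.jM ∘ D.jB j`"):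

* `beltBallPt x ∈ D⁴ ∖ S` — the belt-piece point with vector `x` (`‖x‖ < 1`), smooth on the open ball;
* `handleBallChart D i G x = G.jM (D.jB i (beltBallPt x))` — the open handle in `M'`: smooth and
  injective on the open unit ball, a smooth embedding with open range on every open subset of it
  (`isSmoothEmbedding_handleBallChart`: inverse `jB⁻¹ ∘ jM⁻¹` smooth by
  `contMDiffOn_leftInverse_of_isImmersion`);
* `seamZone a = {x_μ ≠ 0, ‖x_λ‖ < ½, |1 - ‖x‖²| < min (1/5) a}`, `chartDom a = ball ∪ seamZone a`;
* **`gluedHandleChart D i G a x`** `= handleBallChart x` for `‖x‖ < 1`, `= modelChart D i G a x` (the seam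
  chart `ι (seamPt x, seamHeight a x)` of `…DualHandleSeamModelChart.lean`) otherwise; on the seam zone it
  IS the model chart (`gluedHandleChart_of_mem_seamZone`, by `modelChart_of_norm_le_one`), hence smooth
  and injective on `chartDom a`, and around every point of `chartDom a` it restricts to a smooth
  embedding with open range (`exists_isSmoothEmbedding_gluedHandleChart`);
* the charts of two different handles have disjoint images (`gluedHandleChart_ne`).

This is the chart in which the level function `Φ` of the complement piece is written near the `i`-th
cocore (files III–IV).  Everything here is proved; no named facts.

## References
* A. A. Kosinski, *Differential Manifolds* (1993), VI §6. [Kosinski1993]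
* J. Milnor, *Lectures on the h-cobordism theorem* (1965), Thm. 1.4. [MilnorHCobordism1965]
* J. M. Lee, *Introduction to Smooth Manifolds* (2013), Prop. 5.2, Thm. 4.14. [LeeSmoothManifolds2013]
-/

noncomputable section

-- the prescribed namespace `Summit.<P>.<Sub>.…` duplicates `SmoothPoincare4` (P = Sub)
set_option linter.dupNamespace false

open scoped Manifold ContDiff Topology

namespace Summit.SmoothPoincare4.SmoothPoincare4.Theorems.AcyclicBisectionExists.ModpBraidOrbits

open Set Function Metric Topology
open Literature.Topology.FourManifolds Literature.Topology.FourManifolds.HandleAttachingMap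

/-! ### §1 The belt-piece point with a given vector -/

section Ball

/-- `|x_λ|² ≠ 1` inside the open unit ball. [folklore] -/
theorem lamSq_ne_one_of_norm_lt_one {x : EuclideanSpace ℝ (Fin 4)} (h : ‖x‖ < 1) : lamSq 2 x ≠ 1 := by
  rw [← norm_lamPart_sq]
  intro h1
  have h2 := norm_sq_eq_lamPart_muPart x
  nlinarith [norm_nonneg x, sq_nonneg ‖muPart x‖]

/-- The centre of the handle as a belt-piece point. [folklore] -/
def handleCentrePt : ↥(beltPiece 3 2) :=
  ⟨⟨0, mem_closedBall_self zero_le_one⟩, lamSq_ne_one_of_norm_lt_one (by simp)⟩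

open Classical in
/-- **The belt-piece point with vector `x`** (`‖x‖ < 1`; junk: the centre). [cite: Kosinski1993, VI §6] -/
def beltBallPt (x : EuclideanSpace ℝ (Fin 4)) : ↥(beltPiece 3 2) :=
  if h : ‖x‖ < 1 then ⟨⟨x, mem_closedBall_zero_iff.2 h.le⟩, lamSq_ne_one_of_norm_lt_one h⟩ else handleCentrePt

/-- The vector of `beltBallPt x` is `x`. [folklore] -/
@[simp] theorem coe_beltBallPt {x : EuclideanSpace ℝ (Fin 4)} (h : ‖x‖ < 1) :
    (((beltBallPt x : ↥(beltPiece 3 2)) : closedBall (0 : EuclideanSpace ℝ (Fin 4)) 1) :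
      EuclideanSpace ℝ (Fin 4)) = x := by
  rw [beltBallPt, dif_pos h]

/-- `beltBallPt` of the vector of an interior belt-piece point is that point. [folklore] -/
theorem beltBallPt_coe (b : ↥(beltPiece 3 2))
    (h : ‖((b : closedBall (0 : EuclideanSpace ℝ (Fin 4)) 1) : EuclideanSpace ℝ (Fin 4))‖ < 1) :
    beltBallPt ((b : closedBall (0 : EuclideanSpace ℝ (Fin 4)) 1) : EuclideanSpace ℝ (Fin 4)) = b :=
  Subtype.ext (Subtype.ext (coe_beltBallPt h))

/-- `beltBallPt` is injective on the open ball. [folklore] -/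
theorem injOn_beltBallPt : InjOn beltBallPt (ball (0 : EuclideanSpace ℝ (Fin 4)) 1) := by
  intro x hx y hy hxy
  rw [mem_ball_zero_iff] at hx hy
  rw [← coe_beltBallPt hx, ← coe_beltBallPt hy, hxy]

/-- **`beltBallPt` is smooth on the open ball** (into `D⁴` by `codRestrict_closedBall`, then into the
open piece `D⁴ ∖ S`). [folklore] -/
theorem contMDiffOn_beltBallPt :
    ContMDiffOn 𝓘(ℝ, EuclideanSpace ℝ (Fin 4)) (𝓡∂ 4) ∞ beltBallPt (ball (0 : EuclideanSpace ℝ (Fin 4)) 1) := by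
  classical
  intro x hx
  apply ContMDiffAt.contMDiffWithinAt
  rw [mem_ball_zero_iff] at hx
  set f : EuclideanSpace ℝ (Fin 4) → EuclideanSpace ℝ (Fin 4) := fun y => if ‖y‖ < 1 then y else 0 with hf
  have hfD : ∀ y, f y ∈ closedBall (0 : EuclideanSpace ℝ (Fin 4)) 1 := fun y => by
    simp only [hf]
    split_ifs with hy
    · exact mem_closedBall_zero_iff.2 hy.le
    · exact mem_closedBall_self zero_le_one
  have hfs : ContMDiffAt 𝓘(ℝ, EuclideanSpace ℝ (Fin 4)) 𝓘(ℝ, EuclideanSpace ℝ (Fin 4)) ∞ f x := by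
    refine contMDiffAt_id.congr_of_eventuallyEq ?_
    filter_upwards [isOpen_ball.mem_nhds (mem_ball_zero_iff.2 hx)] with y hy
    simp [hf, mem_ball_zero_iff.1 hy]
  have hg := hfs.codRestrict_closedBall (n := 3) hfD
  rw [← ContMDiffAt.subtypeVal_comp_iff]
  refine hg.congr_of_eventuallyEq ?_
  filter_upwards [isOpen_ball.mem_nhds (mem_ball_zero_iff.2 hx)] with y hy
  apply Subtype.ext
  rw [mem_ball_zero_iff] at hy
  show (((beltBallPt y : ↥(beltPiece 3 2)) : closedBall (0 : EuclideanSpace ℝ (Fin 4)) 1) :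
    EuclideanSpace ℝ (Fin 4)) = f y
  rw [coe_beltBallPt hy]
  simp [hf, hy]

variable {B : Type} [TopologicalSpace B] [T2Space B] [ChartedSpace (EuclideanHalfSpace 4) B]
  {ι : Type} [Finite ι] {h : ι → HandleAttachingMap 3 2 B}
  {X : Type} [TopologicalSpace X] [ChartedSpace (EuclideanHalfSpace 4) X] [IsManifold (𝓡∂ 4) ∞ X]
  (D : MultiAttachmentData h (𝓡∂ 4) X) (i : ι) {bX : BoundaryData (𝓡∂ 4) X (𝓡 3)}
  {W : Type} [TopologicalSpace W] [ChartedSpace (EuclideanHalfSpace 4) W]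
  [IsManifold (𝓡∂ 4) ∞ W] {bW : BoundaryData (𝓡∂ 4) W (𝓡 3)} [Nonempty bX.carrier]
  (G : BoundaryGlueData bX bW)

omit [IsManifold (𝓡∂ 4) ∞ X] in
/-- Interior belt-piece points go to interior points of `X`. [folklore] -/
theorem isInteriorPoint_jB {b : ↥(beltPiece 3 2)}
    (hb : ‖((b : closedBall (0 : EuclideanSpace ℝ (Fin 4)) 1) : EuclideanSpace ℝ (Fin 4))‖ < 1) :
    (𝓡∂ 4).IsInteriorPoint (D.jB i b) := by
  rw [ModelWithCorners.isInteriorPoint_iff_not_isBoundaryPoint]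
  intro hbd
  have h1 : D.jB i b ∈ (𝓡∂ 4).boundary X := hbd
  rw [mem_boundary_iff_of_isSmoothEmbedding (D.hjB i).1 (D.hjB i).2, mem_boundary_opens_iff,
    boundary_closedBall] at h1
  exact hb.ne h1

/-- **The open handle in Milnor's gluing**: `x ↦ j_M (D.jB i (beltBallPt x))`. [cite: Kosinski1993, VI §6] -/
def handleBallChart (x : EuclideanSpace ℝ (Fin 4)) : G.d₂.Glued := G.jM (D.jB i (beltBallPt x))

/-- The handle-ball chart is injective on the open ball. [folklore] -/
theorem injOn_handleBallChart : InjOn (handleBallChart D i G) (ball (0 : EuclideanSpace ℝ (Fin 4)) 1) :=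
  fun _ hx _ hy hxy => injOn_beltBallPt hx hy ((D.hjB i).1.isEmbedding.injective (G.injective_jM hxy))

variable [CompactSpace X] [T2Space X] [T2Space W]

/-- The handle-ball chart is smooth on the open ball. [folklore] -/
theorem contMDiffOn_handleBallChart :
    ContMDiffOn 𝓘(ℝ, EuclideanSpace ℝ (Fin 4)) (𝓡 4) ∞ (handleBallChart D i G)
      (ball (0 : EuclideanSpace ℝ (Fin 4)) 1) :=
  (G.isSmoothEmbedding_jM.contMDiff.comp (D.hjB i).1.contMDiff).comp_contMDiffOn contMDiffOn_beltBallPt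

/-- **Open subsets of the ball have open images** (`jB` is open; `jM` is open on the interior). [folklore] -/
theorem isOpen_image_handleBallChart {U : Set (EuclideanSpace ℝ (Fin 4))} (hU : IsOpen U)
    (hUb : U ⊆ ball (0 : EuclideanSpace ℝ (Fin 4)) 1) : IsOpen (handleBallChart D i G '' U) := by
  have h1 : handleBallChart D i G '' U = G.jM '' (D.jB i '' (beltBallPt '' U)) := by
    rw [image_image, image_image]
    rfl
  have h2 : beltBallPt '' U = {b : ↥(beltPiece 3 2) |
      ((b : closedBall (0 : EuclideanSpace ℝ (Fin 4)) 1) : EuclideanSpace ℝ (Fin 4)) ∈ U} := by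
    ext b
    constructor
    · rintro ⟨x, hx, rfl⟩
      show _ ∈ U
      rwa [coe_beltBallPt (mem_ball_zero_iff.1 (hUb hx))]
    · intro hb
      exact ⟨_, hb, beltBallPt_coe b (mem_ball_zero_iff.1 (hUb hb))⟩
  have h3 : IsOpen (beltBallPt '' U) := by
    rw [h2]
    exact (hU.preimage continuous_subtype_val).preimage continuous_subtype_val
  rw [h1]
  refine isOpen_image_of_isSmoothEmbedding_of_subset_interior G.isSmoothEmbedding_jM
    (D.isOpenMap_jB i _ h3) ?_
  rintro _ ⟨b, hb, rfl⟩
  rw [h2] at hb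
  exact isInteriorPoint_jB D i (mem_ball_zero_iff.1 (hUb hb))

/-- **The handle-ball chart is a smooth embedding with open range on every non-empty open subset of the
open ball** (inverse `jB⁻¹ ∘ jM⁻¹`, smooth by `contMDiffOn_leftInverse_of_isImmersion`).
[cite: LeeSmoothManifolds2013, Thm. 4.14] -/
theorem isSmoothEmbedding_handleBallChart (U : TopologicalSpace.Opens (EuclideanSpace ℝ (Fin 4))) [Nonempty U]
    (hU : (U : Set (EuclideanSpace ℝ (Fin 4))) ⊆ ball (0 : EuclideanSpace ℝ (Fin 4)) 1) :
    Manifold.IsSmoothEmbedding 𝓘(ℝ, EuclideanSpace ℝ (Fin 4)) (𝓡 4) ∞ (fun x : U => handleBallChart D i G x) ∧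
      IsOpen (range fun x : U => handleBallChart D i G x) := by
  set jU : U → G.d₂.Glued := fun x => handleBallChart D i G x with hjU
  have hsm : ContMDiff 𝓘(ℝ, EuclideanSpace ℝ (Fin 4)) (𝓡 4) ∞ jU :=
    (contMDiffOn_handleBallChart D i G).comp_contMDiff contMDiff_subtype_val fun x => hU x.2
  have hinj : Injective jU := fun x y hxy =>
    Subtype.ext (injOn_handleBallChart D i G (hU x.2) (hU y.2) hxy)
  have hopen : IsOpenMap jU := by
    intro O hO
    obtain ⟨O', hO', rfl⟩ := isOpen_induced_iff.1 hO
    have h1 : jU '' (Subtype.val ⁻¹' O') = handleBallChart D i G '' (O' ∩ (U : Set _)) := by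
      ext p
      simp only [mem_image, mem_preimage, mem_inter_iff]
      constructor
      · rintro ⟨x, hx, rfl⟩
        exact ⟨x.1, ⟨hx, x.2⟩, rfl⟩
      · rintro ⟨y, ⟨hy, hyU⟩, rfl⟩
        exact ⟨⟨y, hyU⟩, hy, rfl⟩
    rw [h1]
    exact isOpen_image_handleBallChart D i G (hO'.inter U.isOpen) fun x hx => hU hx.2
  have hk : IsOpenEmbedding jU := IsOpenEmbedding.of_continuous_injective_isOpenMap hsm.continuous hinj hopen
  refine ⟨isSmoothEmbedding_of_contMDiffOn_symm hk hsm ?_, hk.isOpen_range⟩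
  -- the inverse on the range: `coe ∘ jB⁻¹ ∘ jM⁻¹`
  haveI : Nonempty X := ⟨D.jB i handleCentrePt⟩
  haveI : Nonempty ↥(beltPiece 3 2) := ⟨handleCentrePt⟩
  have hM : ContMDiffOn (𝓡 4) (𝓡∂ 4) ∞ (invFun G.jM) (range G.jM) :=
    contMDiffOn_leftInverse_of_isImmersion G.isSmoothEmbedding_jM.isImmersion
      G.isSmoothEmbedding_jM.isEmbedding (leftInverse_invFun G.injective_jM)
  have hB : ContMDiffOn (𝓡∂ 4) (𝓡∂ 4) ∞ (invFun (D.jB i)) (range (D.jB i)) :=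
    contMDiffOn_leftInverse_of_isImmersion (D.hjB i).1.isImmersion (D.hjB i).1.isEmbedding
      (leftInverse_invFun (D.hjB i).1.isEmbedding.injective)
  have hcoe : ContMDiff (𝓡∂ 4) 𝓘(ℝ, EuclideanSpace ℝ (Fin 4)) ∞
      fun b : ↥(beltPiece 3 2) => ((b : closedBall (0 : EuclideanSpace ℝ (Fin 4)) 1) : EuclideanSpace ℝ (Fin 4)) :=
    contMDiff_coe_closedBall.comp contMDiff_subtype_val
  have hcomp : ContMDiffOn (𝓡 4) 𝓘(ℝ, EuclideanSpace ℝ (Fin 4)) ∞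
      (fun p => (((invFun (D.jB i) (invFun G.jM p) : ↥(beltPiece 3 2)) :
        closedBall (0 : EuclideanSpace ℝ (Fin 4)) 1) : EuclideanSpace ℝ (Fin 4))) (range jU) := by
    refine hcoe.comp_contMDiffOn (hB.comp (hM.mono ?_) ?_)
    · rintro _ ⟨x, rfl⟩; exact ⟨_, rfl⟩
    · rintro _ ⟨x, rfl⟩
      show invFun G.jM (G.jM (D.jB i (beltBallPt x))) ∈ range (D.jB i)
      rw [leftInverse_invFun G.injective_jM]
      exact mem_range_self _
  have hformula : ∀ x : U, (((invFun (D.jB i) (invFun G.jM (jU x)) : ↥(beltPiece 3 2)) :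
      closedBall (0 : EuclideanSpace ℝ (Fin 4)) 1) : EuclideanSpace ℝ (Fin 4)) = x := fun x => by
    have h1 : invFun G.jM (jU x) = D.jB i (beltBallPt x) := leftInverse_invFun G.injective_jM _
    have h2 : invFun (D.jB i) (D.jB i (beltBallPt x)) = beltBallPt x :=
      leftInverse_invFun (D.hjB i).1.isEmbedding.injective _
    rw [h1, h2, coe_beltBallPt (mem_ball_zero_iff.1 (hU x.2))]
  intro p hp
  rw [← ContMDiffWithinAt.subtypeVal_comp_iff]
  refine (hcomp p hp).congr (fun q hq => ?_) ?_
  · obtain ⟨x, rfl⟩ := hq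
    show ((hk.toOpenPartialHomeomorph jU).symm (jU x) : EuclideanSpace ℝ (Fin 4)) = _
    rw [IsOpenEmbedding.toOpenPartialHomeomorph_left_inv, hformula]
  · obtain ⟨x, rfl⟩ := hp
    show ((hk.toOpenPartialHomeomorph jU).symm (jU x) : EuclideanSpace ℝ (Fin 4)) = _
    rw [IsOpenEmbedding.toOpenPartialHomeomorph_left_inv, hformula]

/-- **Registered helper `helper_handleBallChart_embedding` (sub-goal of `stub_steinRealisation`, T3b (iii),
wave 4, lead c5): the open handle `x ↦ j_M (D.jB i (beltBallPt x))` of Milnor's gluing is a smooth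
embedding with open range on every non-empty open subset of the open unit ball of `ℝ⁴`.**
[cite: LeeSmoothManifolds2013, Thm. 4.14] -/
theorem helper_handleBallChart_embedding : ∀ {B : Type} [TopologicalSpace B] [T2Space B] [ChartedSpace (EuclideanHalfSpace 4) B] {ι : Type} [Finite ι] {h : ι → Literature.Topology.FourManifolds.HandleAttachingMap 3 2 B} {X : Type} [TopologicalSpace X] [ChartedSpace (EuclideanHalfSpace 4) X] [IsManifold (𝓡∂ 4) ∞ X] (D : Literature.Topology.FourManifolds.HandleAttachingMap.MultiAttachmentData h (𝓡∂ 4) X) (i : ι) {bX : Literature.Topology.FourManifolds.BoundaryData (𝓡∂ 4) X (𝓡 3)} {W : Type} [TopologicalSpace W] [ChartedSpace (EuclideanHalfSpace 4) W] [IsManifold (𝓡∂ 4) ∞ W] {bW : Literature.Topology.FourManifolds.BoundaryData (𝓡∂ 4) W (𝓡 3)} [Nonempty bX.carrier] (G : Literature.Topology.FourManifolds.BoundaryGlueData bX bW) [CompactSpace X] [T2Space X] [T2Space W] (U : TopologicalSpace.Opens (EuclideanSpace ℝ (Fin 4))) [Nonempty U], (U : Set (EuclideanSpace ℝ (Fin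 4))) ⊆ Metric.ball (0 : EuclideanSpace ℝ (Fin 4)) 1 → Manifold.IsSmoothEmbedding 𝓘(ℝ, EuclideanSpace ℝ (Fin 4)) (𝓡 4) ∞ (fun x : U => Summit.SmoothPoincare4.SmoothPoincare4.Theorems.AcyclicBisectionExists.ModpBraidOrbits.handleBallChart D i G x) ∧ IsOpen (Set.range fun x : U => Summit.SmoothPoincare4.SmoothPoincare4.Theorems.AcyclicBisectionExists.ModpBraidOrbits.handleBallChart D i G x) := by
  intro B _ _ _ ι _ h X _ _ _ D i bX W _ _ _ bW _ G _ _ _ U _ hU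
  exact isSmoothEmbedding_handleBallChart D i G U hU

end Ball

end Summit.SmoothPoincare4.SmoothPoincare4.Theorems.AcyclicBisectionExists.ModpBraidOrbits

end
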